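import Summits.Ventures.Crystal3D.Theorems.StickyWulffConstantCoaxialWallLawTwoLatticeReadings
import HarnessLib

/-!
# Readings in a TWO-LATTICE configuration Ib: TWIN dozens on `Λ₁ ∪ Λ₂`
# (crux `CoaxialWallLaw`, stmt-Ventures-19481, line `WallLedgerF`; interpretation completeness, part 1b)

HONEST FRAMING. Venture `Summits/Ventures/Crystal3D` (cell `crystal3d-full`), helper `--supports` the crux
`CoaxialWallLaw` of `route-Ventures-StickyWulffConstant` (REGISTERED line `WallLedgerF`).  Rung credit; F-C1 not
moved; no census, no kissing facts; pure lattice geometry continuing `…TwoLatticeReadings` (19481-p2 g7, cf-p1 g28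
§86(79)/(86) item (3)).

* **`twin_reading_twoLattice`** — a TWIN `(G, m)` dozen (lower triangle `q + G ℓ`, mirrors `q + M_m(G ℓ)`) on
  `X ⊆ Λ_a ∪ Λ_b` at `q ∈ Λ_a` forces EITHER `G·slots = L_a·slots` with the lower triangle in `Λ_a ∖ Λ_b` and the
  mirror triangle in `Λ_b ∖ Λ_a`, OR `(M_m ∘ G)·slots = L_a·slots` with the lower triangle in `Λ_b ∖ Λ_a` and the
  mirrors in `Λ_a ∖ Λ_b`.  Mechanism: a lower ball and its mirror differ by `2√(2/3)m` (squared norm `8/3`, not a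
  lattice vector), two lower balls on different sides would give a lattice vector of squared norm `11/3`; the lower
  face (three cappers of `−m`, pairwise `60°`) then registers `G` or `M_m∘G` in `L_a` (`image_fccSlots_eq_of_face_mem`).
WHAT THIS IS NOT: not the row, not the certificate; F-C1 not moved.
-/

noncomputable section

namespace Summit.Ventures.Crystal3D.Theorems

open Summit.Ventures.Crystal3D Finset
open Literature.MathematicalPhysics.StatisticalMechanics (fccStacking)
open scoped InnerProductSpace

section TwoLattice

variable {X : Finset (EuclideanSpace ℝ (Fin 3))}

/-! ### TWIN readings on a two-lattice configuration -/

/-- **TWIN readings on `X ⊆ Λ_a ∪ Λ_b`, base point in `Λ_a`.**  See the module docstring. -/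
theorem twin_reading_twoLattice (La Lb : EuclideanSpace ℝ (Fin 3) ≃ₗᵢ[ℝ] EuclideanSpace ℝ (Fin 3))
    (sa sb : EuclideanSpace ℝ (Fin 3))
    (hX : ∀ x ∈ X, x ∈ (fun p => La p + sa) '' fccStacking 1 (Real.sqrt (2 / 3)) ∨
      x ∈ (fun p => Lb p + sb) '' fccStacking 1 (Real.sqrt (2 / 3)))
    (G : EuclideanSpace ℝ (Fin 3) ≃ₗᵢ[ℝ] EuclideanSpace ℝ (Fin 3)) {m : EuclideanSpace ℝ (Fin 3)} (hm : ‖m‖ = 1)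
    (hmenu : ∀ w ∈ fccSlots, ⟪G w, m⟫_ℝ = 0 ∨ ⟪G w, m⟫_ℝ = Real.sqrt (2 / 3) ∨ ⟪G w, m⟫_ℝ = -Real.sqrt (2 / 3))
    {q : EuclideanSpace ℝ (Fin 3)} (hq : q ∈ (fun p => La p + sa) '' fccStacking 1 (Real.sqrt (2 / 3)))
    (hown : ∀ w ∈ fccSlots, ⟪G w, m⟫_ℝ < 0 → q + G w ∈ X)
    (hmir : ∀ w ∈ fccSlots, ⟪G w, m⟫_ℝ < 0 → q + (G w - (2 * ⟪G w, m⟫_ℝ) • m) ∈ X) :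
    ((G : EuclideanSpace ℝ (Fin 3) → EuclideanSpace ℝ (Fin 3)) '' ↑fccSlots =
        (La : EuclideanSpace ℝ (Fin 3) → EuclideanSpace ℝ (Fin 3)) '' ↑fccSlots ∧
      ∀ w ∈ fccSlots, ⟪G w, m⟫_ℝ < 0 →
        (q + G w ∈ (fun p => La p + sa) '' fccStacking 1 (Real.sqrt (2 / 3)) ∧
          q + G w ∉ (fun p => Lb p + sb) '' fccStacking 1 (Real.sqrt (2 / 3)) ∧
          q + (G w - (2 * ⟪G w, m⟫_ℝ) • m) ∈ (fun p => Lb p + sb) '' fccStacking 1 (Real.sqrt (2 / 3)) ∧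
          q + (G w - (2 * ⟪G w, m⟫_ℝ) • m) ∉ (fun p => La p + sa) '' fccStacking 1 (Real.sqrt (2 / 3)))) ∨
    (((G.trans (ℝ ∙ m)ᗮ.reflection : EuclideanSpace ℝ (Fin 3) ≃ₗᵢ[ℝ] EuclideanSpace ℝ (Fin 3)) :
          EuclideanSpace ℝ (Fin 3) → EuclideanSpace ℝ (Fin 3)) '' ↑fccSlots =
        (La : EuclideanSpace ℝ (Fin 3) → EuclideanSpace ℝ (Fin 3)) '' ↑fccSlots ∧
      ∀ w ∈ fccSlots, ⟪G w, m⟫_ℝ < 0 →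
        (q + G w ∈ (fun p => Lb p + sb) '' fccStacking 1 (Real.sqrt (2 / 3)) ∧
          q + G w ∉ (fun p => La p + sa) '' fccStacking 1 (Real.sqrt (2 / 3)) ∧
          q + (G w - (2 * ⟪G w, m⟫_ℝ) • m) ∈ (fun p => La p + sa) '' fccStacking 1 (Real.sqrt (2 / 3)) ∧
          q + (G w - (2 * ⟪G w, m⟫_ℝ) • m) ∉ (fun p => Lb p + sb) '' fccStacking 1 (Real.sqrt (2 / 3)))) := by
  set Λa := (fun p => La p + sa) '' fccStacking 1 (Real.sqrt (2 / 3)) with hΛa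
  set Λb := (fun p => Lb p + sb) '' fccStacking 1 (Real.sqrt (2 / 3)) with hΛb
  set G' : EuclideanSpace ℝ (Fin 3) ≃ₗᵢ[ℝ] EuclideanSpace ℝ (Fin 3) := G.trans (ℝ ∙ m)ᗮ.reflection with hG'
  have hG'app : ∀ x, G' x = G x - (2 * ⟪G x, m⟫_ℝ) • m := fun x => by
    rw [hG', LinearIsometryEquiv.trans_apply, reflection_unit_apply hm]
  have h23 : Real.sqrt (2 / 3) ^ 2 = 2 / 3 := Real.sq_sqrt (by norm_num)
  have hr : 0 < Real.sqrt (2 / 3) := Real.sqrt_pos.2 (by norm_num)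
  have hneg : ∀ {w : EuclideanSpace ℝ (Fin 3)}, w ∈ fccSlots → ⟪G w, m⟫_ℝ < 0 → ⟪G w, m⟫_ℝ = -Real.sqrt (2 / 3) := by
    intro w hw hlt
    rcases hmenu w hw with h | h | h
    · linarith
    · linarith
    · exact h
  -- the lift `t = 2√(2/3) m` between a lower ball and its mirror is not a lattice vector of either lattice
  set t : EuclideanSpace ℝ (Fin 3) := (2 * Real.sqrt (2 / 3)) • m with ht
  have hmir_eq : ∀ {w : EuclideanSpace ℝ (Fin 3)}, w ∈ fccSlots → ⟪G w, m⟫_ℝ < 0 →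
      G w - (2 * ⟪G w, m⟫_ℝ) • m = G w + t := by
    intro w hw hlt; rw [hneg hw hlt, ht]; module
  have ht_norm : ‖t‖ ^ 2 = ((8 : ℤ) : ℝ) / 3 := by
    rw [ht, norm_smul, mul_pow, hm, Real.norm_eq_abs, sq_abs, mul_pow, h23]; norm_num
  have ht_not : ∀ (L : EuclideanSpace ℝ (Fin 3) ≃ₗᵢ[ℝ] EuclideanSpace ℝ (Fin 3)),
      L.symm t ∉ fccStacking 1 (Real.sqrt (2 / 3)) := fun L =>
    not_mem_fcc_of_norm_sq_eq (n := 8) (by rw [LinearIsometryEquiv.norm_map, ht_norm]) (by decide)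
  -- a lower ball and its mirror never lie in the same lattice
  have split : ∀ (L : EuclideanSpace ℝ (Fin 3) ≃ₗᵢ[ℝ] EuclideanSpace ℝ (Fin 3)) (s : EuclideanSpace ℝ (Fin 3))
      {w : EuclideanSpace ℝ (Fin 3)}, w ∈ fccSlots → ⟪G w, m⟫_ℝ < 0 →
      q + G w ∈ (fun p => L p + s) '' fccStacking 1 (Real.sqrt (2 / 3)) →
      q + (G w - (2 * ⟪G w, m⟫_ℝ) • m) ∉ (fun p => L p + s) '' fccStacking 1 (Real.sqrt (2 / 3)) := by
    intro L s w hw hlt hd hu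
    have := movedFcc_sub_symm_mem L s hu hd
    rw [hmir_eq hw hlt, show q + (G w + t) - (q + G w) = t by abel] at this
    exact ht_not L this
  -- two lower balls on different sides are impossible (`‖slot − t‖² = 11/3`)
  have same_side : ∀ {w w' : EuclideanSpace ℝ (Fin 3)}, w ∈ fccSlots → w' ∈ fccSlots → ⟪G w, m⟫_ℝ < 0 →
      ⟪G w', m⟫_ℝ < 0 → w ≠ w' → q + G w ∈ Λa → q + (G w' - (2 * ⟪G w', m⟫_ℝ) • m) ∈ Λa → False := by
    intro w w' hw hw' hlt hlt' hne hd hu'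
    have hmem := movedFcc_sub_symm_mem La sa hd hu'
    rw [hmir_eq hw' hlt', show q + G w - (q + (G w' + t)) = G (w - w') - t by rw [map_sub]; abel] at hmem
    -- `⟪w, w'⟫ = ½` (both lower for `m`, i.e. upper for `−m`)
    have hmenu' : ∀ v ∈ fccSlots, ⟪G v, -m⟫_ℝ = 0 ∨ ⟪G v, -m⟫_ℝ = Real.sqrt (2 / 3) ∨ ⟪G v, -m⟫_ℝ = -Real.sqrt (2 / 3) := by
      intro v hv
      rcases hmenu v hv with h | h | h
      · left; rw [inner_neg_right, h, neg_zero]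
      · right; right; rw [inner_neg_right, h]
      · right; left; rw [inner_neg_right, h, neg_neg]
    have hww' : ⟪w, w'⟫_ℝ = 1 / 2 :=
      inner_eq_half_of_pos_pos G (by rw [norm_neg, hm]) hmenu' hw hw' hne
        (by rw [inner_neg_right]; linarith) (by rw [inner_neg_right]; linarith)
    have hnorm1 : ‖G (w - w')‖ = 1 := by
      rw [LinearIsometryEquiv.norm_map, norm_eq_one_of_mem_fccSlots (sub_mem_fccSlots_of_inner_eq_half hw hw' hww')]
    have horth : ⟪G (w - w'), t⟫_ℝ = 0 := by
      rw [map_sub, inner_sub_left, ht, inner_smul_right, inner_smul_right, hneg hw hlt, hneg hw' hlt']; ring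
    have hnsq : ‖G (w - w') - t‖ ^ 2 = ((11 : ℤ) : ℝ) / 3 := by
      rw [norm_sub_sq_real, hnorm1, horth, ht_norm]; push_cast; ring
    exact not_mem_fcc_of_norm_sq_eq (n := 11) (by rw [LinearIsometryEquiv.norm_map, hnsq]) (by decide) hmem
  -- three distinct lower slots
  have hmenu' : ∀ v ∈ fccSlots, ⟪G v, -m⟫_ℝ = 0 ∨ ⟪G v, -m⟫_ℝ = Real.sqrt (2 / 3) ∨ ⟪G v, -m⟫_ℝ = -Real.sqrt (2 / 3) := by
    intro v hv
    rcases hmenu v hv with h | h | h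
    · left; rw [inner_neg_right, h, neg_zero]
    · right; right; rw [inner_neg_right, h]
    · right; left; rw [inner_neg_right, h, neg_neg]
  obtain ⟨l₁, hl₁, l₂, hl₂, l₃, hl₃, h12, h13, h23', hn₁, hn₂, hn₃⟩ :=
    exists_three_far_slots G (by rw [norm_neg, hm]) hmenu'
  rw [inner_neg_right, neg_eq_iff_eq_neg] at hn₁ hn₂ hn₃
  have hlt₁ : ⟪G l₁, m⟫_ℝ < 0 := by rw [hn₁]; linarith
  have hlt₂ : ⟪G l₂, m⟫_ℝ < 0 := by rw [hn₂]; linarith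
  have hlt₃ : ⟪G l₃, m⟫_ℝ < 0 := by rw [hn₃]; linarith
  have i12 : ⟪l₁, l₂⟫_ℝ = 1 / 2 := inner_eq_half_of_pos_pos G (by rw [norm_neg, hm]) hmenu' hl₁ hl₂ h12
    (by rw [inner_neg_right]; linarith) (by rw [inner_neg_right]; linarith)
  have i13 : ⟪l₁, l₃⟫_ℝ = 1 / 2 := inner_eq_half_of_pos_pos G (by rw [norm_neg, hm]) hmenu' hl₁ hl₃ h13
    (by rw [inner_neg_right]; linarith) (by rw [inner_neg_right]; linarith)
  have i23 : ⟪l₂, l₃⟫_ℝ = 1 / 2 := inner_eq_half_of_pos_pos G (by rw [norm_neg, hm]) hmenu' hl₂ hl₃ h23'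
    (by rw [inner_neg_right]; linarith) (by rw [inner_neg_right]; linarith)
  -- every lower slot is one of the three… we avoid this: we decide the side of `l₁` and propagate to any lower `w`
  -- side of an arbitrary lower slot relative to `l₁`
  have sideA : q + G l₁ ∈ Λa → ∀ w ∈ fccSlots, ⟪G w, m⟫_ℝ < 0 →
      (q + G w ∈ Λa ∧ q + G w ∉ Λb ∧ q + (G w - (2 * ⟪G w, m⟫_ℝ) • m) ∈ Λb ∧
        q + (G w - (2 * ⟪G w, m⟫_ℝ) • m) ∉ Λa) := by
    intro hd₁ w hw hlt
    have hu₁ : q + (G l₁ - (2 * ⟪G l₁, m⟫_ℝ) • m) ∉ Λa := split La sa hl₁ hlt₁ hd₁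
    -- the mirror of `w` is not in `Λa` unless … ; first `q + G w ∈ Λa`
    have hdw : q + G w ∈ Λa := by
      rcases hX _ (hown w hw hlt) with h | h
      · exact h
      · -- `q + G w ∈ Λb`; then its mirror is in `Λa` (not in `Λb`), contradicting `same_side` with `l₁` unless `w = l₁`
        by_cases hwl : w = l₁
        · subst hwl; exact hd₁
        have huw : q + (G w - (2 * ⟪G w, m⟫_ℝ) • m) ∈ Λa := by
          rcases hX _ (hmir w hw hlt) with h' | h'
          · exact h'
          · exact absurd h' (split Lb sb hw hlt h)
        exact (same_side hl₁ hw hlt₁ hlt (Ne.symm hwl) hd₁ huw).elim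
    have huw : q + (G w - (2 * ⟪G w, m⟫_ℝ) • m) ∉ Λa := split La sa hw hlt hdw
    have huwb : q + (G w - (2 * ⟪G w, m⟫_ℝ) • m) ∈ Λb := (hX _ (hmir w hw hlt)).resolve_left huw
    have hdwb : q + G w ∉ Λb := fun h => split Lb sb hw hlt h huwb
    exact ⟨hdw, hdwb, huwb, huw⟩
  have sideB : q + G l₁ ∉ Λa → ∀ w ∈ fccSlots, ⟪G w, m⟫_ℝ < 0 →
      (q + G w ∈ Λb ∧ q + G w ∉ Λa ∧ q + (G w - (2 * ⟪G w, m⟫_ℝ) • m) ∈ Λa ∧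
        q + (G w - (2 * ⟪G w, m⟫_ℝ) • m) ∉ Λb) := by
    intro hd₁ w hw hlt
    have hd₁b : q + G l₁ ∈ Λb := (hX _ (hown l₁ hl₁ hlt₁)).resolve_left hd₁
    have hu₁b : q + (G l₁ - (2 * ⟪G l₁, m⟫_ℝ) • m) ∉ Λb := split Lb sb hl₁ hlt₁ hd₁b
    have hu₁ : q + (G l₁ - (2 * ⟪G l₁, m⟫_ℝ) • m) ∈ Λa := (hX _ (hmir l₁ hl₁ hlt₁)).resolve_right hu₁b
    have hdw : q + G w ∉ Λa := by
      intro h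
      by_cases hwl : w = l₁
      · subst hwl; exact hd₁ h
      exact same_side hw hl₁ hlt hlt₁ hwl h hu₁
    have hdwb : q + G w ∈ Λb := (hX _ (hown w hw hlt)).resolve_left hdw
    have huwb : q + (G w - (2 * ⟪G w, m⟫_ℝ) • m) ∉ Λb := split Lb sb hw hlt hdwb
    have huw : q + (G w - (2 * ⟪G w, m⟫_ℝ) • m) ∈ Λa := (hX _ (hmir w hw hlt)).resolve_right huwb
    exact ⟨hdwb, hdw, huw, huwb⟩
  by_cases hd₁ : q + G l₁ ∈ Λa
  · left
    have hs := sideA hd₁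
    refine ⟨?_, hs⟩
    have reg : ∀ {w : EuclideanSpace ℝ (Fin 3)}, w ∈ fccSlots → ⟪G w, m⟫_ℝ < 0 →
        La.symm (G w) ∈ fccStacking 1 (Real.sqrt (2 / 3)) := fun hw hlt =>
      (movedFcc_add_mem_iff La sa hq _).1 (hs _ hw hlt).1
    exact image_fccSlots_eq_of_face_mem G La hl₁ hl₂ hl₃ i12 i13 i23 (reg hl₁ hlt₁) (reg hl₂ hlt₂) (reg hl₃ hlt₃)
  · right
    have hs := sideB hd₁
    refine ⟨?_, hs⟩
    have reg : ∀ {w : EuclideanSpace ℝ (Fin 3)}, w ∈ fccSlots → ⟪G w, m⟫_ℝ < 0 →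
        La.symm (G' w) ∈ fccStacking 1 (Real.sqrt (2 / 3)) := fun hw hlt => by
      rw [hG'app]; exact (movedFcc_add_mem_iff La sa hq _).1 (hs _ hw hlt).2.2.1
    exact image_fccSlots_eq_of_face_mem G' La hl₁ hl₂ hl₃ i12 i13 i23 (reg hl₁ hlt₁) (reg hl₂ hlt₂) (reg hl₃ hlt₃)

end TwoLattice

end Summit.Ventures.Crystal3D.Theorems

end
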